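import Mathlib
import HarnessLib

/-!
# The Mellin transform of one transported dilate, in closed form

Helper file (`--supports stmt-RiemannHypothesis-0098`), pure proofs (an elementary exponential integral).  Seat rh-explicit-weil-5
gen11 (file of record `HOME/rh-explicit-weil-5/WEIL5-ZSIDE.md` §1(b)); companion of `WeilTransportFoldCaustic.lean`.

Context (documentation only).  Connes' transport of a seed `S` on `[0,1]` is `𝓔S(x) = e^{x/2} Σ_{m ≤ μ} S(m e^{x-a})` on the window
`[-a, a]`, `μ = e^{2a}`; the dilate `m` lives on `[-a, a − log m]`.  For the monomial seed `S(v) = v^k` the dilate's contribution to the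
Mellin transform `f̂(s) = ∫_{-a}^{a} 𝓔S(x) e^{(s−½)x} dx` is the elementary integral computed here:

* `integral_transportDilate_monomial` : `∫_{-a}^{a − log m} e^{x/2} (m e^{x−a})^k e^{(s−½)x} dx
      = m^k e^{−ka} · (e^{(s+k)(a − log m)} − e^{−(s+k)a}) / (s + k)`   (`s + k ≠ 0`),

whose two terms are `e^{sa} m^{−s}` and `e^{sa} m^{−s} (m/μ)^{s+k}` — summing over the seed's coefficients and over `m ≤ M` gives the
closed form `f̂(s) = e^{sa} D_M(s) M_S(s) − e^{−sa} M_G(s)` of WEIL5-ZSIDE §1 (`D_M` the partial sum of `ζ`).  Standard axioms only.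
-/

set_option linter.dupNamespace false
set_option autoImplicit false

noncomputable section

open Real intervalIntegral

namespace Summit.RiemannHypothesis.RiemannHypothesis.Theorems.WeilTransportFold

/-- Pointwise: the transported monomial dilate times the Mellin kernel is a single complex exponential,
`e^{x/2} (m e^{x−a})^k e^{(s−½)x} = m^k e^{−ka} · e^{(s+k)x}`. -/
theorem transportDilate_integrand_eq (a m : ℝ) (k : ℕ) (s : ℂ) (x : ℝ) :
    (Real.exp (x / 2) : ℂ) * ((m * Real.exp (x - a)) ^ k : ℝ) * Complex.exp ((s - 1 / 2) * x)
      = ((m ^ k * Real.exp (-(k * a)) : ℝ) : ℂ) * Complex.exp ((s + k) * x) := by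
  have h1 : ((m * Real.exp (x - a)) ^ k : ℝ) = m ^ k * Real.exp (-(k * a)) * Real.exp (k * x) := by
    rw [mul_pow, ← Real.exp_nat_mul, mul_assoc, ← Real.exp_add]
    congr 1; congr 1; ring
  rw [h1]
  push_cast
  have h2 : Complex.exp (↑x / 2) * Complex.exp (↑k * ↑x) * Complex.exp ((s - 1 / 2) * ↑x)
      = Complex.exp ((s + ↑k) * ↑x) := by
    rw [← Complex.exp_add, ← Complex.exp_add]; congr 1; ring
  calc Complex.exp (↑x / 2) * (↑m ^ k * Complex.exp (-(↑k * ↑a)) * Complex.exp (↑k * ↑x))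
          * Complex.exp ((s - 1 / 2) * ↑x)
        = ↑m ^ k * Complex.exp (-(↑k * ↑a))
          * (Complex.exp (↑x / 2) * Complex.exp (↑k * ↑x) * Complex.exp ((s - 1 / 2) * ↑x)) := by ring
    _ = ↑m ^ k * Complex.exp (-(↑k * ↑a)) * Complex.exp ((s + ↑k) * ↑x) := by rw [h2]

/-- THE DILATE'S MELLIN TRANSFORM IN CLOSED FORM: for `s + k ≠ 0`,
`∫_{x₀}^{x₁} e^{x/2} (m e^{x−a})^k e^{(s−½)x} dx = m^k e^{−ka} (e^{(s+k)x₁} − e^{(s+k)x₀})/(s+k)` for any real bounds; with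
`x₀ = −a`, `x₁ = a − log m` (the dilate's support in the window) the two terms are `e^{sa}m^{−s}` and `e^{sa}m^{−s}(m/μ)^{s+k}`. -/
theorem integral_transportDilate_monomial (a m x₀ x₁ : ℝ) (k : ℕ) (s : ℂ) (hs : s + k ≠ 0) :
    ∫ x in x₀..x₁, (Real.exp (x / 2) : ℂ) * ((m * Real.exp (x - a)) ^ k : ℝ) * Complex.exp ((s - 1 / 2) * x)
      = ((m ^ k * Real.exp (-(k * a)) : ℝ) : ℂ)
          * ((Complex.exp ((s + k) * x₁) - Complex.exp ((s + k) * x₀)) / (s + k)) := by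
  simp_rw [transportDilate_integrand_eq]
  rw [intervalIntegral.integral_const_mul, integral_exp_mul_complex hs]

/-- The upper endpoint term at `x₁ = a − log m` (`m > 0`): `e^{(s+k)(a − log m)} · m^k e^{−ka} = e^{sa} · e^{−s log m}`
(= `e^{sa} m^{−s}`). -/
theorem endpoint_upper (a m : ℝ) (hm : 0 < m) (k : ℕ) (s : ℂ) :
    ((m ^ k * Real.exp (-(k * a)) : ℝ) : ℂ) * Complex.exp ((s + k) * ((a - Real.log m : ℝ) : ℂ))
      = Complex.exp (s * a) * Complex.exp (-(s * Real.log m)) := by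
  have hmk : ((m ^ k : ℝ) : ℂ) = Complex.exp (k * Real.log m) := by
    rw [← Real.exp_log (pow_pos hm k), Real.log_pow, Complex.ofReal_exp]; push_cast; ring_nf
  push_cast
  have : (↑m : ℂ) ^ k = Complex.exp (↑k * ↑(Real.log m)) := by exact_mod_cast hmk
  rw [this, ← Complex.exp_add, ← Complex.exp_add, ← Complex.exp_add]
  congr 1; ring

/-- The lower endpoint term at `x₀ = −a`: `e^{−(s+k)a} · m^k e^{−ka} = e^{sa} · e^{−s log m} · e^{(s+k)(log m − 2a)}`
(= `e^{sa} m^{−s} (m/μ)^{s+k}` with `μ = e^{2a}`). -/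
theorem endpoint_lower (a m : ℝ) (hm : 0 < m) (k : ℕ) (s : ℂ) :
    ((m ^ k * Real.exp (-(k * a)) : ℝ) : ℂ) * Complex.exp ((s + k) * ((-a : ℝ) : ℂ))
      = Complex.exp (s * a) * Complex.exp (-(s * Real.log m)) * Complex.exp ((s + k) * (Real.log m - 2 * a)) := by
  have hmk : ((m ^ k : ℝ) : ℂ) = Complex.exp (k * Real.log m) := by
    rw [← Real.exp_log (pow_pos hm k), Real.log_pow, Complex.ofReal_exp]; push_cast; ring_nf
  push_cast
  have : (↑m : ℂ) ^ k = Complex.exp (↑k * ↑(Real.log m)) := by exact_mod_cast hmk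
  rw [this, ← Complex.exp_add, ← Complex.exp_add, ← Complex.exp_add, ← Complex.exp_add]
  congr 1; ring

end Summit.RiemannHypothesis.RiemannHypothesis.Theorems.WeilTransportFold

end
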